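import Mathlib
import Summits.ValiantsHypothesis.ValiantsHypothesis.Theses.LiouvilleSarnak
import Summits.ValiantsHypothesis.ValiantsHypothesis.Theorems.LiouvilleSarnakDigitalBilinearLiouvilleRectanglesCoarse

/-!
# Route LiouvilleSarnak — crux `DigitalBilinearLiouville` (stmt-ValiantsHypothesis-14774):
# the crux HOLDS for COARSE test vectors, under every cut (unconditional)

`DigitalBilinearLiouville`: for every `ε > 0` and all large `n`, for every balanced cut `π` and ALL test
vectors `u, w`, `|Σ_{r,c} u(r) w(c) λ(N_π(r,c) + 1)|² ≤ ε · 4^n · ‖u‖² ‖w‖²`.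
`Theorems/LiouvilleSarnakDigitalBilinearLiouvilleRectanglesCoarse.lean` proved the indicator case for
COARSE rectangles.  This file proves the crux's own `ℓ²`-normalised inequality for all COARSE test vectors
— `u(r)` independent of the row digits at positions `< L(ε)` and `w(c)` independent of the column digits at
positions `< L(ε)` — under EVERY cut, with no largeness condition on `n` beyond `L ≤ 2n`:

* `sum_range_mul_eq_sum_sum` — `Σ_{m < K B} f(m) = Σ_{H < B} Σ_{a < K} f(K H + a)`.
* `sum_pairs_eq_sum_range` — re-indexing `Σ_{r,c} F(r,c) = Σ_{m < 4^n} F(Q m)` along the bijection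
  `(r, c) ↦ N_π(r, c)`, with the explicit inverse `Q m = (bits of m at row positions, at column positions)`.
* ★ `digitalBilinear_coarse` — for every `ε > 0` there is `L` such that for every `n`, every balanced cut
  `π` (`L ≤ 2n`) and all coarse `u, w : {0,1}^n → ℂ`,
  `‖Σ_r Σ_c u(r) w(c) λ(N_π(r,c)+1)‖² ≤ ε · 4^n · (Σ_r ‖u r‖²) · (Σ_c ‖w c‖²)`.
  Proof: on the number side the weight `c(m) = u w (Q m)` is constant on aligned `2^L`-blocks, so the sum is
  `Σ_H c̃(H) S_H` with `S_H` the block sums of `λ`; Cauchy–Schwarz gives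
  `‖·‖² ≤ (Σ_H |c̃(H)|²)(Σ_H S_H²) = 2^{-L} ‖u‖²‖w‖² · Σ_H S_H²`, and `Σ_H S_H² ≤ 2^L Σ_H |S_H| ≤ 2^L · ε 2^L 4^n/2^L`
  by Matomäki–Radziwiłł (tree `Transposed.sum_abs_dyadicBlockSum_le`, PROVED).

So for every cut the crux is EXACTLY the statement about test vectors that feel the lowest `L(ε)` digits.
Honest framing: unconditional partial result; `DigitalBilinearLiouville`, `LiouvilleCutRank`,
`AlgebraicSarnak` stay OPEN; nothing here bears on VP versus VNP.  No definitions.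
-/

-- the directory `ValiantsHypothesis/ValiantsHypothesis` repeats the summit name (tree layout)
set_option linter.dupNamespace false

namespace Summit.ValiantsHypothesis.ValiantsHypothesis.Theorems.LiouvilleSarnakDigitalBilinearLiouville.Coarse

open Finset ArithmeticFunction

open Summit.ValiantsHypothesis.ValiantsHypothesis.Theorems.LiouvilleSarnak.AlignedTypeI.Transposed
  (sum_abs_dyadicBlockSum_le)

/-- `Σ_{m < K·B} f(m) = Σ_{H < B} Σ_{a < K} f(K H + a)` (`K > 0`). [folklore] -/
theorem sum_range_mul_eq_sum_sum {M : Type*} [AddCommMonoid M] (K B : ℕ) (hK : 0 < K) (f : ℕ → M) :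
    ∑ m ∈ range (K * B), f m = ∑ H ∈ range B, ∑ a ∈ range K, f (K * H + a) := by
  rw [← sum_product' (f := fun H a => f (K * H + a))]
  symm
  refine sum_nbij' (fun x => K * x.1 + x.2) (fun m => (m / K, m % K)) ?_ ?_ ?_ ?_ ?_
  · rintro ⟨H, a⟩ hx
    simp only [mem_product, mem_range] at hx ⊢
    calc K * H + a < K * H + K := by omega
      _ = K * (H + 1) := by ring
      _ ≤ K * B := Nat.mul_le_mul_left K hx.1
  · intro m hm
    simp only [mem_product, mem_range] at hm ⊢
    exact ⟨(Nat.div_lt_iff_lt_mul hK).mpr (by rwa [Nat.mul_comm] at hm), Nat.mod_lt _ hK⟩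
  · rintro ⟨H, a⟩ hx
    simp only [mem_product, mem_range] at hx
    ext
    · show (K * H + a) / K = H
      rw [Nat.mul_add_div hK, Nat.div_eq_of_lt hx.2, add_zero]
    · show (K * H + a) % K = a
      rw [Nat.mul_add_mod, Nat.mod_eq_of_lt hx.2]
  · intro m _
    exact Nat.div_add_mod m K
  · intro x _; rfl

/-- **Re-indexing along the cut bijection.**  With `Q m = (digits of m at the row positions, digits of
m at the column positions)`, `Σ_{(r,c)} F(r, c) = Σ_{m < 4^n} F(Q m)` and `N_π(Q m) = m`. [folklore] -/
theorem sum_pairs_eq_sum_range {M : Type*} [AddCommMonoid M] (n : ℕ) (π : Fin n ⊕ Fin n ≃ Fin (2 * n))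
    (F : (Fin n → Bool) × (Fin n → Bool) → M) :
    ∑ p : (Fin n → Bool) × (Fin n → Bool), F p =
      ∑ m ∈ range (2 ^ (2 * n)), F (fun i => m.testBit (π (Sum.inl i)), fun i => m.testBit (π (Sum.inr i))) := by
  classical
  set N : (Fin n → Bool) × (Fin n → Bool) → ℕ := fun p =>
    Nat.ofBits (fun j : Fin (2 * n) => Sum.elim p.1 p.2 (π.symm j)) with hN
  set Q : ℕ → (Fin n → Bool) × (Fin n → Bool) := fun m =>
    (fun i => m.testBit (π (Sum.inl i)), fun i => m.testBit (π (Sum.inr i))) with hQ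
  have hQN : ∀ p, Q (N p) = p := by
    intro p
    ext i
    · show (N p).testBit (π (Sum.inl i)) = p.1 i
      have := testBit_cutNumber' n π p.1 p.2 (π (Sum.inl i))
      simpa only [Equiv.symm_apply_apply, Sum.elim_inl] using this
    · show (N p).testBit (π (Sum.inr i)) = p.2 i
      have := testBit_cutNumber' n π p.1 p.2 (π (Sum.inr i))
      simpa only [Equiv.symm_apply_apply, Sum.elim_inr] using this
  have hNQ : ∀ m < 2 ^ (2 * n), N (Q m) = m := by
    intro m hm
    have hfun : (fun j : Fin (2 * n) => Sum.elim (Q m).1 (Q m).2 (π.symm j)) =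
        fun j : Fin (2 * n) => m.testBit j := by
      funext j
      rcases h : π.symm j with k | k
      · have hk : π (Sum.inl k) = j := by rw [← h, Equiv.apply_symm_apply]
        simp [hQ, hk]
      · have hk : π (Sum.inr k) = j := by rw [← h, Equiv.apply_symm_apply]
        simp [hQ, hk]
    change Nat.ofBits _ = m
    rw [hfun]
    apply Nat.eq_of_testBit_eq
    intro j
    by_cases hj : j < 2 * n
    · rw [Nat.testBit_ofBits_lt _ _ hj]
    · rw [Nat.testBit_ofBits_ge _ _ (not_lt.mp hj), Nat.testBit_lt_two_pow]
      exact hm.trans_le (Nat.pow_le_pow_right Nat.two_pos (not_lt.mp hj))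
  change ∑ p, F p = ∑ m ∈ range (2 ^ (2 * n)), F (Q m)
  refine sum_nbij' N Q (fun p _ => mem_range.mpr (Nat.ofBits_lt_two_pow _))
    (fun _ _ => mem_univ _) (fun p _ => hQN p) (fun m hm => hNQ m (mem_range.mp hm)) ?_
  intro p _
  rw [hQN]

/-- ★ **`DigitalBilinearLiouville` for coarse test vectors, unconditionally and for every cut.**  For
every `ε > 0` there is `L` such that for every `n`, every balanced cut `π` of the `2n` positions
(`L ≤ 2n`) and all `u, w : {0,1}^n → ℂ` with `u(r)` independent of the row digits at positions `< L` and
`w(c)` independent of the column digits at positions `< L`,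
`‖Σ_r Σ_c u(r) w(c) λ(N_π(r,c) + 1)‖² ≤ ε · 4^n · (Σ_r ‖u r‖²) · (Σ_c ‖w c‖²)` — the crux's inequality
verbatim on this class. [cite: MatomakiRadziwillAnnals2016, Theorem 1] -/
theorem digitalBilinear_coarse :
    ∀ ε : ℝ, 0 < ε → ∃ L : ℕ, ∀ n : ℕ, ∀ π : Fin n ⊕ Fin n ≃ Fin (2 * n), L ≤ 2 * n →
      ∀ u w : (Fin n → Bool) → ℂ,
        (∀ r r' : Fin n → Bool, (∀ i : Fin n, L ≤ (π (Sum.inl i) : ℕ) → r' i = r i) → u r' = u r) →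
        (∀ c c' : Fin n → Bool, (∀ i : Fin n, L ≤ (π (Sum.inr i) : ℕ) → c' i = c i) → w c' = w c) →
        ‖∑ r : Fin n → Bool, ∑ c : Fin n → Bool, u r * w c *
            ((liouville (Nat.ofBits (fun j : Fin (2 * n) => Sum.elim r c (π.symm j)) + 1) : ℤ) : ℂ)‖ ^ 2
          ≤ ε * 4 ^ n * (∑ r : Fin n → Bool, ‖u r‖ ^ 2) * (∑ c : Fin n → Bool, ‖w c‖ ^ 2) := by
  classical
  intro ε hε
  obtain ⟨L, hL⟩ := sum_abs_dyadicBlockSum_le hε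
  refine ⟨L, fun n π hLn u w hu hw => ?_⟩
  -- the weight on the number side and the block sums
  set Q : ℕ → (Fin n → Bool) × (Fin n → Bool) := fun m =>
    (fun i => m.testBit (π (Sum.inl i)), fun i => m.testBit (π (Sum.inr i))) with hQ
  set g : ℕ → ℂ := fun m => u (Q m).1 * w (Q m).2 with hg
  set S : ℕ → ℝ := fun H => ∑ a ∈ range (2 ^ L), (liouville (a + 2 ^ L * H + 1) : ℝ) with hS
  have hKpos : 0 < 2 ^ L := Nat.two_pow_pos L
  have hKB : 2 ^ L * 2 ^ (2 * n - L) = 2 ^ (2 * n) := by rw [← pow_add]; congr 1; omega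
  -- `g` is constant on aligned blocks: `g (2^L H + a) = g (2^L H)` for `a < 2^L`
  have hconst : ∀ H a : ℕ, a < 2 ^ L → g (2 ^ L * H + a) = g (2 ^ L * H) := by
    intro H a ha
    have hbit : ∀ j : ℕ, L ≤ j → (2 ^ L * H + a).testBit j = (2 ^ L * H).testBit j := by
      intro j hj
      have hdiv1 : (2 ^ L * H + a) / 2 ^ L = H := by
        rw [Nat.mul_add_div hKpos, Nat.div_eq_of_lt ha, add_zero]
      have hdiv2 : (2 ^ L * H) / 2 ^ L = H := Nat.mul_div_cancel_left H hKpos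
      have e1 : (2 ^ L * H + a).testBit j = H.testBit (j - L) := by
        rw [show j = (j - L) + L by omega, ← Nat.testBit_div_two_pow, hdiv1]
        congr 1; omega
      have e2 : (2 ^ L * H).testBit j = H.testBit (j - L) := by
        rw [show j = (j - L) + L by omega, ← Nat.testBit_div_two_pow, hdiv2]
        congr 1; omega
      rw [e1, e2]
    have h1 : u (Q (2 ^ L * H + a)).1 = u (Q (2 ^ L * H)).1 :=
      hu _ _ fun i hi => by simp only [hQ]; exact hbit _ hi
    have h2 : w (Q (2 ^ L * H + a)).2 = w (Q (2 ^ L * H)).2 :=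
      hw _ _ fun i hi => by simp only [hQ]; exact hbit _ hi
    simp only [hg, h1, h2]
  -- Step 1: re-index and group by blocks
  have hstep1 : ∑ r : Fin n → Bool, ∑ c : Fin n → Bool, u r * w c *
      ((liouville (Nat.ofBits (fun j : Fin (2 * n) => Sum.elim r c (π.symm j)) + 1) : ℤ) : ℂ) =
      ∑ H ∈ range (2 ^ (2 * n - L)), g (2 ^ L * H) * (S H : ℂ) := by
    rw [← Fintype.sum_prod_type' (f := fun r c => u r * w c *
      ((liouville (Nat.ofBits (fun j : Fin (2 * n) => Sum.elim r c (π.symm j)) + 1) : ℤ) : ℂ))]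
    rw [sum_pairs_eq_sum_range n π, ← hKB, sum_range_mul_eq_sum_sum (2 ^ L) (2 ^ (2 * n - L)) hKpos]
    refine sum_congr rfl fun H hH => ?_
    have hNQ : ∀ a ∈ range (2 ^ L), (Nat.ofBits (fun j : Fin (2 * n) =>
        Sum.elim (Q (2 ^ L * H + a)).1 (Q (2 ^ L * H + a)).2 (π.symm j))) = 2 ^ L * H + a := by
      intro a ha
      have hm : 2 ^ L * H + a < 2 ^ (2 * n) := by
        have hH' : H < 2 ^ (2 * n - L) := mem_range.mp hH
        rw [← hKB]
        calc 2 ^ L * H + a < 2 ^ L * H + 2 ^ L := by have := mem_range.mp ha; omega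
          _ = 2 ^ L * (H + 1) := by ring
          _ ≤ 2 ^ L * 2 ^ (2 * n - L) := Nat.mul_le_mul_left _ hH'
      have hfun : (fun j : Fin (2 * n) =>
          Sum.elim (Q (2 ^ L * H + a)).1 (Q (2 ^ L * H + a)).2 (π.symm j)) =
          fun j : Fin (2 * n) => (2 ^ L * H + a).testBit j := by
        funext j
        rcases h : π.symm j with k | k
        · have hk : π (Sum.inl k) = j := by rw [← h, Equiv.apply_symm_apply]
          simp [hQ, hk]
        · have hk : π (Sum.inr k) = j := by rw [← h, Equiv.apply_symm_apply]
          simp [hQ, hk]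
      rw [hfun]
      apply Nat.eq_of_testBit_eq
      intro j
      by_cases hj : j < 2 * n
      · rw [Nat.testBit_ofBits_lt _ _ hj]
      · rw [Nat.testBit_ofBits_ge _ _ (not_lt.mp hj), Nat.testBit_lt_two_pow]
        exact hm.trans_le (Nat.pow_le_pow_right Nat.two_pos (not_lt.mp hj))
    rw [hS]
    push_cast
    rw [mul_sum]
    refine sum_congr rfl fun a ha => ?_
    rw [hNQ a ha, ← hconst H a (mem_range.mp ha)]
    simp only [hg, hQ, Nat.add_comm a (2 ^ L * H)]
  -- Step 2: Cauchy–Schwarz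
  have hCS : ‖∑ H ∈ range (2 ^ (2 * n - L)), g (2 ^ L * H) * (S H : ℂ)‖ ^ 2 ≤
      (∑ H ∈ range (2 ^ (2 * n - L)), ‖g (2 ^ L * H)‖ ^ 2) *
        (∑ H ∈ range (2 ^ (2 * n - L)), S H ^ 2) := by
    have h1 : ‖∑ H ∈ range (2 ^ (2 * n - L)), g (2 ^ L * H) * (S H : ℂ)‖ ≤
        ∑ H ∈ range (2 ^ (2 * n - L)), ‖g (2 ^ L * H)‖ * |S H| := by
      refine (norm_sum_le _ _).trans (le_of_eq ?_)
      refine sum_congr rfl fun H _ => ?_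
      rw [norm_mul, Complex.norm_real, Real.norm_eq_abs]
    have h2 := Finset.sum_mul_sq_le_sq_mul_sq (range (2 ^ (2 * n - L)))
      (fun H => ‖g (2 ^ L * H)‖) (fun H => |S H|)
    calc ‖∑ H ∈ range (2 ^ (2 * n - L)), g (2 ^ L * H) * (S H : ℂ)‖ ^ 2
        ≤ (∑ H ∈ range (2 ^ (2 * n - L)), ‖g (2 ^ L * H)‖ * |S H|) ^ 2 :=
          pow_le_pow_left₀ (norm_nonneg _) h1 2
      _ ≤ (∑ H ∈ range (2 ^ (2 * n - L)), ‖g (2 ^ L * H)‖ ^ 2) *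
            (∑ H ∈ range (2 ^ (2 * n - L)), |S H| ^ 2) := h2
      _ = _ := by simp only [sq_abs]
  -- Step 3: `2^L · Σ_H ‖g(2^L H)‖² = ‖u‖² ‖w‖²`
  have hgsum : (2 : ℝ) ^ L * ∑ H ∈ range (2 ^ (2 * n - L)), ‖g (2 ^ L * H)‖ ^ 2 =
      (∑ r : Fin n → Bool, ‖u r‖ ^ 2) * (∑ c : Fin n → Bool, ‖w c‖ ^ 2) := by
    have h1 : (∑ r : Fin n → Bool, ‖u r‖ ^ 2) * (∑ c : Fin n → Bool, ‖w c‖ ^ 2) =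
        ∑ p : (Fin n → Bool) × (Fin n → Bool), ‖u p.1 * w p.2‖ ^ 2 := by
      rw [sum_mul_sum, ← Fintype.sum_prod_type']
      refine Fintype.sum_congr _ _ fun p => ?_
      rw [norm_mul, mul_pow]
    rw [h1, sum_pairs_eq_sum_range n π, ← hKB,
      sum_range_mul_eq_sum_sum (2 ^ L) (2 ^ (2 * n - L)) hKpos, mul_sum]
    refine sum_congr rfl fun H _ => ?_
    have : ∀ a ∈ range (2 ^ L),
        ‖u (Q (2 ^ L * H + a)).1 * w (Q (2 ^ L * H + a)).2‖ ^ 2 = ‖g (2 ^ L * H)‖ ^ 2 := by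
      intro a ha
      rw [← hconst H a (mem_range.mp ha)]
    rw [sum_congr rfl this, sum_const, card_range, nsmul_eq_mul]
    push_cast
    ring
  -- Step 4: `Σ_H S_H² ≤ 2^L · Σ_H |S_H| ≤ 2^L · ε 2^L 2^{2n-L}`
  have hSabs : ∀ H, |S H| ≤ (2 : ℝ) ^ L := by
    intro H
    refine (abs_sum_le_sum_abs _ _).trans ?_
    have : ∀ a ∈ range (2 ^ L), |(liouville (a + 2 ^ L * H + 1) : ℝ)| ≤ 1 := by
      intro a _
      rw [liouville_apply (Nat.succ_ne_zero _)]
      rcases neg_one_pow_eq_or ℤ (cardFactors (a + 2 ^ L * H + 1)) with h | h <;> simp [h]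
    refine (sum_le_sum this).trans ?_
    simp
  have hSsq : ∑ H ∈ range (2 ^ (2 * n - L)), S H ^ 2 ≤
      (2 : ℝ) ^ L * (ε * 2 ^ L * (2 ^ (2 * n - L) : ℕ)) := by
    have hMR := hL L le_rfl (2 ^ (2 * n - L))
    calc ∑ H ∈ range (2 ^ (2 * n - L)), S H ^ 2
        = ∑ H ∈ range (2 ^ (2 * n - L)), |S H| * |S H| := by
          refine sum_congr rfl fun H _ => ?_; rw [← sq_abs, sq]
      _ ≤ ∑ H ∈ range (2 ^ (2 * n - L)), (2 : ℝ) ^ L * |S H| :=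
          sum_le_sum fun H _ => mul_le_mul_of_nonneg_right (hSabs H) (abs_nonneg _)
      _ = (2 : ℝ) ^ L * ∑ H ∈ range (2 ^ (2 * n - L)), |S H| := by rw [mul_sum]
      _ ≤ (2 : ℝ) ^ L * (ε * 2 ^ L * (2 ^ (2 * n - L) : ℕ)) :=
          mul_le_mul_of_nonneg_left hMR (by positivity)
  -- assemble
  have hKB' : (2 : ℝ) ^ L * ((2 ^ (2 * n - L) : ℕ) : ℝ) = 4 ^ n := by
    have : (((2 ^ L * 2 ^ (2 * n - L) : ℕ)) : ℝ) = ((2 ^ (2 * n) : ℕ) : ℝ) := by rw [hKB]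
    push_cast at this ⊢
    rw [this, pow_mul]; norm_num
  rw [hstep1]
  calc ‖∑ H ∈ range (2 ^ (2 * n - L)), g (2 ^ L * H) * (S H : ℂ)‖ ^ 2
      ≤ (∑ H ∈ range (2 ^ (2 * n - L)), ‖g (2 ^ L * H)‖ ^ 2) *
          (∑ H ∈ range (2 ^ (2 * n - L)), S H ^ 2) := hCS
    _ ≤ (∑ H ∈ range (2 ^ (2 * n - L)), ‖g (2 ^ L * H)‖ ^ 2) *
          ((2 : ℝ) ^ L * (ε * 2 ^ L * (2 ^ (2 * n - L) : ℕ))) :=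
        mul_le_mul_of_nonneg_left hSsq (sum_nonneg fun _ _ => by positivity)
    _ = ε * ((2 : ℝ) ^ L * ((2 ^ (2 * n - L) : ℕ) : ℝ)) *
          ((2 : ℝ) ^ L * ∑ H ∈ range (2 ^ (2 * n - L)), ‖g (2 ^ L * H)‖ ^ 2) := by ring
    _ = ε * 4 ^ n * ((∑ r : Fin n → Bool, ‖u r‖ ^ 2) * (∑ c : Fin n → Bool, ‖w c‖ ^ 2)) := by
        rw [hKB', hgsum]
    _ = _ := by ring

end Summit.ValiantsHypothesis.ValiantsHypothesis.Theorems.LiouvilleSarnakDigitalBilinearLiouville.Coarse
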